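import Summits.Ventures.PercRepro2.CaseOneStarCfQt21
import Summits.Ventures.PercRepro2.CaseOneStarCfQt21SplitA
import Summits.Ventures.PercRepro2.CaseOneStarCfQt21SplitB

/-!
# The marked star: `cfQt21_bern` re-proved in small kernel steps
(blind cell PercRepro2, p1 g18; S5 §2.1 (K9) (q); OPS l.38 (i) — RULING (F) 2026-08-25T23:42:22Z)

The `(r, s)`-Bernstein coefficients `cBQt21kl` of CaseOneStarCfQt21.lean are integer combinations of the monomial
coefficients `aQt21ij` (CaseOneStarCfQt21Mono.lean): `cBQt21kl = Σ_{i ≤ k, j ≤ l} c(k,i) c(l,j) aQt21ij` with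
`c(k,i) = 3 · C(k,i) / C(3,i)` (`cBQt21kl_eq`); for the index pairs without a Bernstein coefficient the combination
vanishes (`aQt21vkl`). With the monomial expansion `cfQt21_mono` the Bernstein identity `cfQt21_bern'` — the SAME
statement as `cfQt21_bern` — is a linear identity in `r`, `s` and the atoms `aQt21ij m`; every step elaborates
on a referee node (the cell identities are spread over modules so that each file stays small in kernel memory). -/

namespace Summit.Ventures.PercRepro2

namespace CaseOne

section CfQt21Split
variable {R : Type*} [CommRing R]

set_option maxHeartbeats 0 in
/-- **The `(r, s)`-Bernstein form of `cfQt21`** (the statement of `cfQt21_bern`, verbatim), proved in small kernel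
steps: the monomial expansion, the coefficient identities, then one linear step. -/
theorem cfQt21_bern' (r s : R) (m : SCells R) :
    9 * cfQt21 r s m = (1 : R) * r ^ 0 * (1 - r) ^ 3 * s ^ 0 * (1 - s) ^ 3 * cBQt2100 m + (3 : R) * r ^ 0 * (1 - r) ^ 3 * s ^ 1 * (1 - s) ^ 2 * cBQt2101 m + (3 : R) * r ^ 0 * (1 - r) ^ 3 * s ^ 2 * (1 - s) ^ 1 * cBQt2102 m + (1 : R) * r ^ 0 * (1 - r) ^ 3 * s ^ 3 * (1 - s) ^ 0 * cBQt2103 m + (3 : R) * r ^ 1 * (1 - r) ^ 2 * s ^ 0 * (1 - s) ^ 3 * cBQt2110 m + (9 : R) * r ^ 1 * (1 - r) ^ 2 * s ^ 1 * (1 - s) ^ 2 * cBQt2111 m + (9 : R) * r ^ 1 * (1 - r) ^ 2 * s ^ 2 * (1 - s) ^ 1 * cBQt2112 m + (3 : R) * r ^ 1 * (1 - r) ^ 2 * s ^ 3 * (1 - s) ^ 0 * cBQt2113 m + (3 : R) * r ^ 2 * (1 - r) ^ 1 * s ^ 0 * (1 - s) ^ 3 * cBQt2120 m + (9 : R) *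 r ^ 2 * (1 - r) ^ 1 * s ^ 1 * (1 - s) ^ 2 * cBQt2121 m + (9 : R) * r ^ 2 * (1 - r) ^ 1 * s ^ 2 * (1 - s) ^ 1 * cBQt2122 m + (3 : R) * r ^ 2 * (1 - r) ^ 1 * s ^ 3 * (1 - s) ^ 0 * cBQt2123 m + (1 : R) * r ^ 3 * (1 - r) ^ 0 * s ^ 0 * (1 - s) ^ 3 * cBQt2130 m + (3 : R) * r ^ 3 * (1 - r) ^ 0 * s ^ 1 * (1 - s) ^ 2 * cBQt2131 m + (3 : R) * r ^ 3 * (1 - r) ^ 0 * s ^ 2 * (1 - s) ^ 1 * cBQt2132 m + (1 : R) * r ^ 3 * (1 - r) ^ 0 * s ^ 3 * (1 - s) ^ 0 * cBQt2133 m := by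
  rw [cfQt21_mono, cBQt2100_eq, cBQt2101_eq, cBQt2102_eq, cBQt2103_eq, cBQt2110_eq, cBQt2111_eq, cBQt2112_eq, cBQt2113_eq, cBQt2120_eq, cBQt2121_eq, cBQt2122_eq, cBQt2123_eq, cBQt2130_eq, cBQt2131_eq, cBQt2132_eq, cBQt2133_eq]
  ring

end CfQt21Split

end CaseOne

end Summit.Ventures.PercRepro2
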